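import Summits.CriticalPhenomena.PercolationContinuityZ3.Theorems.PercNearOneGluingNoHeavyQuantSGCTopLowCapacity
import Summits.CriticalPhenomena.PercolationContinuityZ3.Theorems.PercNearOneGluingNoHeavyQuantSDEC
import HarnessLib

/-!
# QUANT lane R8, the GRADED-CLOSURE programme (lead g37 RULING V364), part 3: the DEPTH-2 row family `LawDec.TLC2`
# (two-threshold price staircases) and its necessity for DEC — the typed hypothesis side of G₁

builds on p205010 (kernel theorem, internal audit signed; external expert review pending)

Support file (`--supports stmt-CriticalPhenomena-4575`), QUANT lane seat prim-quant-census-2 (gen 64), rung R8 of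
`run/shared/lean/prim/quant/LADDER.md`; lane INBOX 2026-08-24 l.1366 (RULING V364: "G₁ needs a typed depth-2 family … and an adversarial test at M ≥ 20
BEFORE any filing").  One `Prop` definition with parameters (`LawDec.TLC2`), theorems with standard axioms, no sorries.  Parts 1–2: `…QuantDepthOneRows`
(`LawDec.TLC` = depth ≤ 1), `…QuantDepthOneClosure` (node G₀).  Census memo: `run/shared/lean/prim/quant/prim-quant-census-2-g64/G0-CENSUS-G64.md` §7.

THE STAIRCASE PICTURE (memo §7).  By LP duality for the flow form of DEC(j′) (`LawDec.FlowAtT`; weak half `dual_le_of_decAtT`), a law `ν` is DEC(j′) at floor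
`x`, target `T` iff for every PRICE `α ≥ 0` on the lows that is antitone in the low (WLOG, because `usage` is antitone in the low, `usage_anti_low`)
`Σ_l α_l ν(l) ≤ Σ_h β_h(α) ν(h)` with `β_h(α) = max_{l compatible with h} α_l / usage(l, h)`.  One threshold (`α = u·[l ≤ i′]`, `u = x/(1−x)`) is the
top-low-capacity row TLCR(j′, i′) of `LawDec.TLC` (depth 1); TWO thresholds `i″ < i′` with ratio `θ ∈ [0, 1]` (`α = u·([l ≤ i″] + θ·[i″ < l ≤ i′])`) give
the DEPTH-2 rows of this file:

  `TLC2 x T M ν`:  for all `j′ < M`, `i″ < i′ ≤ j′` with `2i′ < T`, `0 ≤ θ ≤ 1`: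
  `u·(Σ_{l ≤ i″} ν l + θ·Σ_{i″ < l ≤ i′} ν l) ≤ Σ_{h ≤ M, h > j′} ν h + u·Σ_{h ≤ j′} ν h · max([T < i″+h]/usage(i″,h), θ·[T < i′+h]/usage(i′,h))`.

For fixed `(j′, i″, i′)` the slack is convex piecewise-linear in `θ`, so numerically the family is finitely many rows (kinks `θ = usage(i′,h)/usage(i″,h)`);
`θ = 1` is TLCR(j′, i′), `θ = 0` is TLCR(j′, i″).  KERNEL (this file): **`IsFlowAtT.twoThreshold_le`** — every flow witness at layer `j′` satisfies the row
(each low `l ≤ i″` pays `usage(l,h) ≥ usage(i″,h)` on a mid compatible with it, each low `i″ < l ≤ i′` pays `≥ usage(i′,h)`, giants absorb at rate `u ≥ α_l`;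
no sign, mean or top-affordability hypothesis on `ν` is needed, exactly as in census-2 g63's `lowMass_le_giants_add_midCapacity`), hence `tlc2_of_flowAtT`,
`tlc2_of_decAt_all` (DEC at all layers `j′ < M` ⟹ `TLC2` at the mean) and `tlc2_gate_of_decAt_all` (in `SingleGateConvClosed`'s binder the gated factor is `TLC2`).

WHY (census-2 g64, exact; memo §4, §7): the depth-1 class {TLB, TLC} is NOT closed under gated convolution — 118 exact witnesses from `M = 14`, e.g. `q = 1`,
`y = 1/4`, `μ₁ = {0: ½, 1: ½}`, `μ₂ = {1: 9/16, 2: 3/16, 4: 15/224, 18: 41/224}` (TLB- and TLC-clean), product row TLCR(7, 2) short by `1/448` — and EVERY such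
witness factor violates a depth-2 row (60 / 60 checked), while 14 962 exact DEC laws satisfy all depth-2 rows (0 exceptions, as this file proves).  The graded
conjecture G₁ ('{TLB, TLC, TLC2} of both gated factors ⟹ TLC of the gated convolution') is being tested adversarially (kits on item stmt-CriticalPhenomena-4575)
and is NOT stated here.  HONEST STATUS: nothing in the lane's RATE class log\* or honest sentence (`run/shared/lean/prim/quant/README.md`) changes.

[this work]; flows, usage, the single-threshold row: prim-quant-stmt g22, prim-quant-census-2 g63 (this lane).  LP duality for flows with gains is classical;
nothing here is cited as a published result.  The gluing rows served [cite: KozmaNitzan2024, Conjecture 3 (p. 15)]; product measure [cite: Grimmett1999, §1.3 p. 10].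
-/

noncomputable section

namespace Summit.CriticalPhenomena.PercolationContinuityZ3.Theorems

namespace Quant

open Finset

namespace LawDec

/-! ### The depth-2 family -/

/-- **the depth-2 capacity coefficient of an atom `h ≤ j′`** for the thresholds `i″ < i′` at ratio `θ`:
`max([T < i″ + h]/usage(i″, h), θ·[T < i′ + h]/usage(i′, h))` — the best price-per-usage any priced low can claim on `h`. [this work] -/
def cap2 (x T : ℝ) (j' i'' i' h : ℕ) (θ : ℝ) : ℝ :=
  max (if T < (i'' : ℝ) + h then 1 / usage x T j' i'' h else 0) (if T < (i' : ℝ) + h then θ / usage x T j' i' h else 0)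

/-- **THE DEPTH-2 ROW FAMILY `TLC2 x T M ν`** (two-threshold price staircases): for all layers `j′ < M`, thresholds `i″ < i′ ≤ j′` with `2i′ < T`
and ratios `0 ≤ θ ≤ 1`,
`x/(1−x)·(Σ_{l ≤ i″} ν l + θ·Σ_{i″ < l ≤ i′} ν l) ≤ Σ_{h ≤ M, h > j′} ν h + x/(1−x)·Σ_{h ≤ M, h ≤ j′} ν h · cap2 x T j′ i″ i′ h θ`. [this work] -/
def TLC2 (x T : ℝ) (M : ℕ) (ν : ℕ → ℝ) : Prop :=
  ∀ j' i'' i' : ℕ, ∀ θ : ℝ, j' < M → i'' < i' → i' ≤ j' → 2 * (i' : ℝ) < T → 0 ≤ θ → θ ≤ 1 →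
    x / (1 - x) * (∑ l ∈ Finset.range (i'' + 1), ν l + θ * ∑ l ∈ Finset.Ico (i'' + 1) (i' + 1), ν l)
      ≤ ∑ h ∈ Finset.range (M + 1), (if j' + 1 ≤ h then ν h else 0)
        + x / (1 - x) * ∑ h ∈ Finset.range (M + 1), (if h ≤ j' then ν h * cap2 x T j' i'' i' h θ else 0)

/-- `cap2` is nonnegative (its first branch is; `0 < x < 1`, `2i′ < T`, `i″ < i′`; any `θ`). [this work] -/
theorem cap2_nonneg (x T : ℝ) (j' i'' i' h : ℕ) (θ : ℝ) (hx0 : 0 < x) (hx1 : x < 1) (hii : i'' < i') (hlow : 2 * (i' : ℝ) < T) :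
    0 ≤ cap2 x T j' i'' i' h θ := by
  unfold cap2
  refine le_max_of_le_left ?_
  split_ifs with hc
  · have hlow'' : 2 * (i'' : ℝ) < T := by
      have : (i'' : ℝ) < i' := by exact_mod_cast hii
      linarith
    have hih : i'' < h := by
      have : (i'' : ℝ) < h := by linarith
      exact_mod_cast this
    exact (one_div_pos.2 (usage_pos_of_compat x T j' i'' h hx0 hx1 hlow'' hih (Or.inr hc))).le
  · exact le_rfl

/-! ### Necessity: a flow witness satisfies every depth-2 row -/

/-- **TWO-THRESHOLD CAPACITY BOUND (depth-2 necessary condition of DEC(j′)).**  `f` a flow witness of `μ` at `(x, T, j′)` on `{0..M}`, `0 < x < 1`,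
thresholds `i″ < i′ ≤ j′` with `2i′ < T`, ratio `0 ≤ θ ≤ 1`.  Then the `TLC2` row holds: the price `α_l = u` (`l ≤ i″`), `uθ` (`i″ < l ≤ i′`) of each
low is covered on every absorber it uses — on a giant because `α_l ≤ u = usage`, on a compatible mid `h` because `usage(l, h) ≥ usage(i″, h)` resp.
`≥ usage(i′, h)` (`usage_anti_low`) — and the loads on `h` add up to `≤ μ h`. [this work] -/
theorem IsFlowAtT.twoThreshold_le {x T : ℝ} {j' M : ℕ} {μ : ℕ → ℝ} {f : ℕ → ℕ → ℝ}
    (hF : IsFlowAtT x T j' M μ f) (hx0 : 0 < x) (hx1 : x < 1) (i'' i' : ℕ) (hii : i'' < i') (hi' : i' ≤ j')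
    (hlow : 2 * (i' : ℝ) < T) (θ : ℝ) (hθ0 : 0 ≤ θ) (hθ1 : θ ≤ 1) :
    x / (1 - x) * (∑ l ∈ Finset.range (i'' + 1), μ l + θ * ∑ l ∈ Finset.Ico (i'' + 1) (i' + 1), μ l)
      ≤ ∑ h ∈ Finset.range (M + 1), (if j' + 1 ≤ h then μ h else 0)
        + x / (1 - x) * ∑ h ∈ Finset.range (M + 1), (if h ≤ j' then μ h * cap2 x T j' i'' i' h θ else 0) := by
  classical
  obtain ⟨hf0, hsupp, hrow, hcol⟩ := hF
  have h1x : 0 < 1 - x := by linarith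
  have hu0 : 0 ≤ x / (1 - x) := div_nonneg hx0.le h1x.le
  set u : ℝ := x / (1 - x) with hu
  have hlow'' : 2 * (i'' : ℝ) < T := by
    have : (i'' : ℝ) < i' := by exact_mod_cast hii
    linarith
  -- the price of a low
  set α : ℕ → ℝ := fun l => if l ≤ i'' then u else if l ≤ i' then u * θ else 0 with hα
  have hα0 : ∀ l, 0 ≤ α l := by
    intro l; simp only [hα]; split_ifs
    · exact hu0
    · exact mul_nonneg hu0 hθ0
    · exact le_rfl
  have hαu : ∀ l, α l ≤ u := by
    intro l; simp only [hα]; split_ifs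
    · exact le_rfl
    · nlinarith
    · exact hu0
  -- every `l ≤ i′` is a low of layer `j′`
  have hlowl : ∀ l, l < i' + 1 → l ≤ j' ∧ 2 * (l : ℝ) < T := by
    intro l hl
    have hli : l ≤ i' := Nat.lt_succ_iff.1 hl
    refine ⟨hli.trans hi', ?_⟩
    have : (l : ℝ) ≤ i' := by exact_mod_cast hli
    linarith
  -- `usage · f` terms are nonnegative
  have huf0 : ∀ l h, 0 ≤ usage x T j' l h * f l h := by
    intro l h
    rcases (hf0 l h).eq_or_lt with hz | hpos
    · rw [← hz, mul_zero]
    · obtain ⟨_, hl2, _, habs⟩ := hsupp l h hpos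
      have hlh : l < h := by
        rcases habs with hg | hm
        · have := (hsupp l h hpos).1; omega
        · have : (l : ℝ) < h := by linarith
          exact_mod_cast this
      exact mul_nonneg (usage_pos_of_compat x T j' l h hx0 hx1 hl2 hlh habs).le hpos.le
  -- (1) the left side as a priced flow: Σ_{l ≤ i′} α_l μ_l = Σ_h Σ_{l ≤ i′} α_l f l h
  have hLHS : u * (∑ l ∈ Finset.range (i'' + 1), μ l + θ * ∑ l ∈ Finset.Ico (i'' + 1) (i' + 1), μ l)
      = ∑ l ∈ Finset.range (i' + 1), α l * μ l := by
    have hsplit : ∑ l ∈ Finset.range (i' + 1), α l * μ l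
        = ∑ l ∈ Finset.range (i'' + 1), α l * μ l + ∑ l ∈ Finset.Ico (i'' + 1) (i' + 1), α l * μ l :=
      (Finset.sum_range_add_sum_Ico _ (by omega)).symm
    rw [hsplit]
    have e1 : ∑ l ∈ Finset.range (i'' + 1), α l * μ l = u * ∑ l ∈ Finset.range (i'' + 1), μ l := by
      rw [Finset.mul_sum]
      refine Finset.sum_congr rfl fun l hl => ?_
      rw [Finset.mem_range] at hl
      simp only [hα, if_pos (Nat.lt_succ_iff.1 hl)]
    have e2 : ∑ l ∈ Finset.Ico (i'' + 1) (i' + 1), α l * μ l = u * θ * ∑ l ∈ Finset.Ico (i'' + 1) (i' + 1), μ l := by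
      rw [Finset.mul_sum]
      refine Finset.sum_congr rfl fun l hl => ?_
      rw [Finset.mem_Ico] at hl
      simp only [hα, if_neg (by omega : ¬ l ≤ i''), if_pos (by omega : l ≤ i')]
    rw [e1, e2]; ring
  have hmass : ∑ l ∈ Finset.range (i' + 1), α l * μ l
      = ∑ h ∈ Finset.range (M + 1), ∑ l ∈ Finset.range (i' + 1), α l * f l h := by
    rw [Finset.sum_comm]
    refine Finset.sum_congr rfl fun l hl => ?_
    rw [Finset.mem_range] at hl
    rw [← Finset.mul_sum, hrow l (hlowl l hl).1 (hlowl l hl).2]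
  rw [hLHS, hmass, Finset.mul_sum, ← Finset.sum_add_distrib]
  refine Finset.sum_le_sum fun h hh => ?_
  rw [Finset.mem_range] at hh
  have hhM : h ≤ M := by omega
  by_cases hg : j' + 1 ≤ h
  · -- giant column: every price is at most `u = usage`
    rw [if_pos hg, if_neg (by omega : ¬ h ≤ j'), mul_zero, add_zero]
    have hc := hcol h hhM (Or.inl hg)
    have hu' : ∀ l ∈ Finset.range (j' + 1), usage x T j' l h * f l h = u * f l h :=
      fun l _ => by rw [usage_giant_eq _ _ _ _ _ hg]
    rw [Finset.sum_congr rfl hu', ← Finset.mul_sum] at hc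
    have hstep : ∑ l ∈ Finset.range (i' + 1), α l * f l h ≤ ∑ l ∈ Finset.range (i' + 1), u * f l h :=
      Finset.sum_le_sum fun l _ => mul_le_mul_of_nonneg_right (hαu l) (hf0 l h)
    have hsub : ∑ l ∈ Finset.range (i' + 1), u * f l h ≤ ∑ l ∈ Finset.range (j' + 1), u * f l h :=
      Finset.sum_le_sum_of_subset_of_nonneg (Finset.range_mono (by omega)) (fun l _ _ => mul_nonneg hu0 (hf0 l h))
    rw [Finset.mul_sum] at hc
    exact hstep.trans (hsub.trans hc)
  · rw [if_neg hg, zero_add]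
    have hhj : h ≤ j' := by omega
    rw [if_pos hhj]
    by_cases hcomp : T < (i' : ℝ) + h
    · -- a mid compatible with `i′` (hence an absorber: `T ≤ 2h`)
      have hmid : T ≤ 2 * (h : ℝ) := by
        have : (i' : ℝ) < h := by linarith
        linarith
      have hcap0 : 0 ≤ cap2 x T j' i'' i' h θ := cap2_nonneg x T j' i'' i' h θ hx0 hx1 hii hlow
      -- each priced unit pays at least its price / cap2 in usage
      have hstep : ∀ l ∈ Finset.range (i' + 1), α l * f l h ≤ (u * cap2 x T j' i'' i' h θ) * (usage x T j' l h * f l h) := by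
        intro l hl
        rw [Finset.mem_range] at hl
        rcases (hf0 l h).eq_or_lt with hz | hpos
        · rw [← hz, mul_zero, mul_zero, mul_zero]
        · obtain ⟨_, hl2, _, habs⟩ := hsupp l h hpos
          have hcl : T < (l : ℝ) + h := by
            rcases habs with hg' | hm
            · exact absurd hg' hg
            · exact hm
          have hli : l ≤ i' := Nat.lt_succ_iff.1 hl
          have hlh : l < h := by
            have : (l : ℝ) < h := by linarith
            exact_mod_cast this
          have hupos : 0 < usage x T j' l h := usage_pos_of_compat x T j' l h hx0 hx1 hl2 hlh (Or.inr hcl)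
          rw [show (u * cap2 x T j' i'' i' h θ) * (usage x T j' l h * f l h)
              = (u * cap2 x T j' i'' i' h θ * usage x T j' l h) * f l h by ring]
          refine mul_le_mul_of_nonneg_right ?_ hpos.le
          by_cases hli'' : l ≤ i''
          · -- price `u`; `cap2 ≥ 1/usage(i″,h)` and `usage(l,h) ≥ usage(i″,h)`
            simp only [hα, if_pos hli'']
            have hci'' : T < (i'' : ℝ) + h := by
              have : (l : ℝ) ≤ i'' := by exact_mod_cast hli''
              linarith
            have hi''h : i'' < h := by
              have : (i'' : ℝ) < h := by linarith
              exact_mod_cast this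
            have hupos'' : 0 < usage x T j' i'' h := usage_pos_of_compat x T j' i'' h hx0 hx1 hlow'' hi''h (Or.inr hci'')
            have hanti : usage x T j' i'' h ≤ usage x T j' l h := by
              rcases hli''.eq_or_lt with heq | hlt
              · rw [heq]
              · exact usage_anti_low x T j' l i'' h hx0 hx1 hlt hlow'' hcl (Or.inr hmid)
            have hcap : 1 / usage x T j' i'' h ≤ cap2 x T j' i'' i' h θ := by
              unfold cap2; rw [if_pos hci'']; exact le_max_left _ _
            calc u = u * (1 / usage x T j' i'' h * usage x T j' i'' h) := by
                  rw [one_div_mul_cancel hupos''.ne', mul_one]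
              _ ≤ u * (cap2 x T j' i'' i' h θ * usage x T j' l h) := by
                  refine mul_le_mul_of_nonneg_left ?_ hu0
                  exact mul_le_mul hcap hanti hupos''.le hcap0
              _ = u * cap2 x T j' i'' i' h θ * usage x T j' l h := by ring
          · -- price `uθ`; `cap2 ≥ θ/usage(i′,h)` and `usage(l,h) ≥ usage(i′,h)`
            simp only [hα, if_neg hli'', if_pos hli]
            have hi'h : i' < h := by
              have : (i' : ℝ) < h := by linarith
              exact_mod_cast this
            have hupos' : 0 < usage x T j' i' h := usage_pos_of_compat x T j' i' h hx0 hx1 hlow hi'h (Or.inr hcomp)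
            have hanti : usage x T j' i' h ≤ usage x T j' l h := by
              rcases hli.eq_or_lt with heq | hlt
              · rw [heq]
              · exact usage_anti_low x T j' l i' h hx0 hx1 hlt hlow hcl (Or.inr hmid)
            have hcap : θ / usage x T j' i' h ≤ cap2 x T j' i'' i' h θ := by
              unfold cap2; rw [if_pos hcomp]; exact le_max_right _ _
            calc u * θ = u * (θ / usage x T j' i' h * usage x T j' i' h) := by
                  rw [div_mul_cancel₀ θ hupos'.ne']
              _ ≤ u * (cap2 x T j' i'' i' h θ * usage x T j' l h) := by
                  refine mul_le_mul_of_nonneg_left ?_ hu0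
                  exact mul_le_mul hcap hanti hupos'.le hcap0
              _ = u * cap2 x T j' i'' i' h θ * usage x T j' l h := by ring
      calc ∑ l ∈ Finset.range (i' + 1), α l * f l h
          ≤ ∑ l ∈ Finset.range (i' + 1), (u * cap2 x T j' i'' i' h θ) * (usage x T j' l h * f l h) := Finset.sum_le_sum hstep
        _ = (u * cap2 x T j' i'' i' h θ) * ∑ l ∈ Finset.range (i' + 1), usage x T j' l h * f l h := by rw [Finset.mul_sum]
        _ ≤ (u * cap2 x T j' i'' i' h θ) * ∑ l ∈ Finset.range (j' + 1), usage x T j' l h * f l h := by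
            refine mul_le_mul_of_nonneg_left ?_ (mul_nonneg hu0 hcap0)
            exact Finset.sum_le_sum_of_subset_of_nonneg (Finset.range_mono (by omega)) (fun l _ _ => huf0 l h)
        _ ≤ (u * cap2 x T j' i'' i' h θ) * μ h := mul_le_mul_of_nonneg_left (hcol h hhM (Or.inr hmid)) (mul_nonneg hu0 hcap0)
        _ = u * (μ h * cap2 x T j' i'' i' h θ) := by ring
    · -- not compatible with `i′`: no priced low uses `h`, and `cap2 = 0`
      have hci'' : ¬ T < (i'' : ℝ) + h := by
        intro hc
        have : (i'' : ℝ) ≤ i' := by exact_mod_cast hii.le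
        exact hcomp (by linarith)
      have hcap : cap2 x T j' i'' i' h θ = 0 := by
        unfold cap2; rw [if_neg hci'', if_neg hcomp, max_self]
      rw [hcap, mul_zero, mul_zero]
      have hz : ∑ l ∈ Finset.range (i' + 1), α l * f l h = 0 := by
        refine Finset.sum_eq_zero fun l hl => ?_
        rw [Finset.mem_range] at hl
        rcases (hf0 l h).eq_or_lt with hz | hpos
        · rw [← hz, mul_zero]
        · obtain ⟨_, _, _, habs⟩ := hsupp l h hpos
          rcases habs with hg' | hm
          · exact absurd hg' hg
          · have : (l : ℝ) ≤ i' := by exact_mod_cast Nat.lt_succ_iff.1 hl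
            exact absurd (by linarith) hcomp
      rw [hz]

/-- **a flow witness at every layer below the top gives `TLC2`** (`0 < x < 1`). [this work] -/
theorem tlc2_of_flowAtT {x T : ℝ} {M : ℕ} {ν : ℕ → ℝ} (hx0 : 0 < x) (hx1 : x < 1)
    (hF : ∀ j', j' < M → FlowAtT x T j' M ν) : TLC2 x T M ν := by
  intro j' i'' i' θ hj hii hi' hlow hθ0 hθ1
  obtain ⟨f, hf⟩ := (flowAtT_iff_exists_isFlowAtT x T j' M ν).1 (hF j' hj)
  exact hf.twoThreshold_le hx0 hx1 i'' i' hii hi' hlow θ hθ0 hθ1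

/-- **DEC at every layer below the top gives `TLC2` at the mean** (`0 < x < 1`), through `flowAtT_of_decAtT`. [this work] -/
theorem tlc2_of_decAt_all {x : ℝ} {M : ℕ} {ν : ℕ → ℝ} (hx0 : 0 < x) (hx1 : x < 1)
    (hdec : ∀ j', j' < M → DECAt x j' M ν) :
    TLC2 x (∑ h ∈ Finset.range (M + 1), (h : ℝ) * ν h) M ν :=
  tlc2_of_flowAtT hx0 hx1 fun j' hj =>
    flowAtT_of_decAtT x _ j' M ν hx0 hx1 ((decAt_iff_decAtT x j' M ν).1 (hdec j' hj))

/-- **in the binder of `LawDec.SingleGateConvClosed` the gated factor satisfies `TLC2`** at floor `y`, target `q·T` (DEC of `gate μ q` at every layer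
`j′ < M`; its mean is `q·T`, `sum_mul_gate`). [this work] -/
theorem tlc2_gate_of_decAt_all {y q : ℝ} {M : ℕ} {μ : ℕ → ℝ} (hy0 : 0 < y) (hy1 : y < 1)
    (hdec : ∀ j', j' < M → DECAt y j' M (gate μ q)) :
    TLC2 y (q * ∑ h ∈ Finset.range (M + 1), (h : ℝ) * μ h) M (gate μ q) := by
  rw [← sum_mul_gate]
  exact tlc2_of_decAt_all hy0 hy1 hdec

end LawDec

end Quant

end Summit.CriticalPhenomena.PercolationContinuityZ3.Theorems
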